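import Summits.ResolutionOfSingularities.ResolutionOfSingularities.Theorems.WeightedInvariantELadderOneStage
import Summits.ResolutionOfSingularities.ResolutionOfSingularities.Theorems.WeightedInvariantWeightedThesisTowerGenericQuotient
import Summits.ResolutionOfSingularities.ResolutionOfSingularities.Theorems.WeightedInvariantHypersurfaceAdmissibleSequencesDim
import Literature.AlgebraicGeometry.Resolution.BlowupsExistence
import HarnessLib

/-!
# THE ABSTRACT LADDER ASSEMBLY — strong induction on a well-founded measure along the cobordant tower, for an
# arbitrary stage invariant `Inv`, measure `μ` and drop predicate `Drop` (every rung `e` of the door's e-ladder)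

Route `ResolutionOfSingularities/WeightedInvariant`, door crux `HypersurfaceCentreConstruction`
(stmt-ResolutionOfSingularities-19897) — OURS, helper (counted 0); ORDER (o54) of the registrar res-L1-w43-plan-1
(HOME/STATUS 2026-08-27T14:12:08Z) for tier E2 of door skeleton v3.9 (PART 6 `stub_e2_consumer`), hand res-L1-w43-stub-3.

`ELadderOne.e1_assembly_unconditional` (`Theorems/WeightedInvariantELadderOneRungUnconditional.lean` l.41–120; the
registered `e1_assembly` of `…ELadderOneRung` is the same text) proves `S.toPair.Resolvable` for every stage `S` with
`S.Inv'` by strong induction on `S.mu : ℕ∞` along the cobordant tower, consuming exactly two inputs: a CENTRE step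
(`exists_isAdmissibleCentre`: a singular stage carries an admissible centre supported on `singImage` whose cobordant
blow-up satisfies the rung's drop condition) and a SUCCESSOR step (`stub_e1_inv_succ`: the successor stage produced by
the tree's quotient step satisfies the invariant again and has strictly smaller measure).  THIS FILE abstracts the
things rung `e = 1` hard-wires — the invariant `Stage.Inv'`, the measure `Stage.mu`, the support equation
`R.support = singImage S.i.ker` and the drop line `∀ b, R'.πPlus b ∈ S.maxSing → idealOrder (R'.strictTransformPlus
S.i.ker) b < idealOrder S.i.ker (R'.πPlus b)` — into parameters `Inv : Stage k → Prop`, `μ : Stage k → W` (`W` any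
type with a well-founded `<`) and an OPAQUE `Good : (S : Stage k) → ReesAlgebraData S.Y → Prop` (registrar's
AMENDMENT 14:13:09Z: rung `e = 2`'s centre is supported on the maximum locus of `ι`, a proper closed subset of
`singImage` in general, so the support equation must not be hard-wired; the generic-point-off-the-centre fact `hξ`
becomes an OUTPUT of the centre step):

* **`ELadder.ladder_assembly Inv μ Good centre succ S hInv : S.toPair.Resolvable`** — the shape of record:
  `centre : ∀ S, Inv S → ¬ IsRegular S.X → ∃ R, IsAdmissibleCentre S.f S.i.ker R ∧ S.i (genericPoint S.X) ∉ R.support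
  ∧ Good S R`; `succ : ∀ S, Inv S → ¬ IsRegular S.X → ∀ R, IsAdmissibleCentre … R → S.i (genericPoint S.X) ∉
  R.support → Good S R → ∀ R', R'.ideal = R.piece → ∀ [instances] hlp' V' ρ q' hq' 𝒜', Inv ⟨successor⟩ ∧
  μ ⟨successor⟩ < μ S` (the remaining binders = those of `ELadderOne.stub_e1_inv_succ`, `…ELadderOneInvSucc.lean`
  l.136, VERBATIM); the proof is the l.41–120 text with these substitutions (the tower machinery — smoothness of
  `R'.πPlus ≫ S.f`, integrality and local principality of the strict transform, the (hom) clause of admissibility on the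
  charts, `DatumToEmbedded.quotientStep_of_isRegularWeightedCentre`, `exists_isBlowup` — is rung-independent);
* `ELadder.genericPoint_not_mem_support_of_support_eq` — l.55–63 extracted: `R.support = singImage S.i.ker ⇒
  S.i (genericPoint S.X) ∉ R.support`;
* `ELadder.ladder_assembly_of_support_eq Inv μ Drop centre succ S hInv` — the corollary with `Good S R :=
  R.support = singImage S.i.ker ∧ ∀ R', R'.ideal = R.piece → Drop S R'`, whose `centre` / `succ` binders are those of
  `ELadderOne.exists_isAdmissibleCentre` / `ELadderOne.stub_e1_inv_succ` with `S.Inv' ↦ Inv S`, `S.mu ↦ μ S`, the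
  `hdrop` line `↦ Drop S R'` — rung `e = 1` feeds both tree theorems to it with NO adapter (sanity corollary, filed
  separately as `…ELadderAssemblyRungOne.lean` so that THIS module carries no rung-1 import).

WHY: skeleton v3.10 splits `stub_e2_consumer` into `stub_e2_base'` / `stub_e2_centre` / `stub_e2_inv_succ` over
(o47)'s `Inv₂ ι J`, `mu₂ ι : Stage k → Ordinal`, `Good₂ ι J` and proves `e2_assembly := ladder_assembly …`.

[OURS · L1 W4.3 · door tier E2 · pure port, scheme-light]  A theorem about OUR typed objects (`ELadderOne.Stage`,
`HypersurfacePair.Resolvable`, admissible centres / cobordant blow-ups à la Abramovich–Quek–Schober–Włodarczyk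
[cite: Wlodarczyk2022, §2.3.3, Thm 1.1.4 (5); AbramovichQuekSchober2025, Thm 1.1]); it replaces the role of NO printed
item and is NOT a statement of H. Hironaka's manuscript [claim: Hironaka2017, status: under-review].  AI-written;
gate-checked ≠ expert-reviewed.
-/

noncomputable section

set_option linter.dupNamespace false -- mandated namespace of this single-conjunct summit

open CategoryTheory AlgebraicGeometry TopologicalSpace IsLocalRing
open Literature.AlgebraicGeometry.Resolution
open Summit.ResolutionOfSingularities.ResolutionOfSingularities.Theorems
open Summit.ResolutionOfSingularities.ResolutionOfSingularities.Theorems.ELadderOne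

namespace Summit.ResolutionOfSingularities.ResolutionOfSingularities.Theorems.ELadder

variable {k : Type} [Field k]

/-- **THE ABSTRACT LADDER ASSEMBLY (registrar's shape of record, AMENDMENT 14:13:09Z).**  Let `Inv` be a property of
stages, `μ` a measure of stages with values in a type `W` whose `<` is well founded, and `Good S R` an opaque property
of Rees-algebra data on the ambient of a stage (whatever the successor step needs beyond admissibility: the support
equation, the rung's drop condition, …).  Suppose (CENTRE) every singular stage with `Inv` carries an ADMISSIBLE centre
`R` with the generic point of the hypersurface OFF its support and `Good S R`, and (SUCCESSOR) for every such `S, R` and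
every Rees filtration `R'` with `R'.ideal = R.piece` the successor stage built by the tree's quotient step (ambient
`R'.plus`, hypersurface the strict transform, any blow-up `ρ : V' → S.V` of the quotient with a lifted quotient map `q'`
and a graded atlas of rank `S.j + 1`) satisfies `Inv` and has strictly smaller `μ`.  Then EVERY stage with `Inv` has a
resolvable hypersurface pair — strong induction on `μ S` along the cobordant tower; the text of
`ELadderOne.e1_assembly_unconditional` (l.41–120) with `Stage.Inv' ↦ Inv`, `Stage.mu ↦ μ`, the support/drop data
`↦ Good`, and the generic-point fact `hξ` now an OUTPUT of `centre` (rung `e = 2`'s centre is supported on the maximum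
locus of `ι`, a proper closed subset of `singImage` in general). [cite: Wlodarczyk2022, §2.3.3, Thm 1.1.4 (5)] -/
theorem ladder_assembly [PerfectField k] {W : Type} [LT W] [WellFoundedLT W]
    (Inv : Stage k → Prop) (μ : Stage k → W) (Good : (S : Stage k) → ReesAlgebraData S.Y → Prop)
    (centre : ∀ S : Stage k, Inv S → ¬ Scheme.IsRegular S.X →
      ∃ R : ReesAlgebraData S.Y, IsAdmissibleCentre S.f S.i.ker R ∧ S.i (genericPoint S.X) ∉ R.support ∧ Good S R)
    (succ : ∀ (S : Stage k), Inv S → ¬ Scheme.IsRegular S.X →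
      ∀ (R : ReesAlgebraData S.Y), IsAdmissibleCentre S.f S.i.ker R → S.i (genericPoint S.X) ∉ R.support →
        Good S R → ∀ (R' : ReesFiltration S.Y), R'.ideal = R.piece →
      ∀ [Smooth (R'.πPlus ≫ S.f)] [IsSeparated (R'.πPlus ≫ S.f)] [QuasiCompact (R'.πPlus ≫ S.f)]
        [IsIntegral (R'.strictTransformPlus S.i.ker).subscheme]
        (hlp' : IsLocallyPrincipal (R'.strictTransformPlus S.i.ker).subschemeι.ker)
        (V' : Scheme.{0}) (ρ : V' ⟶ S.V) [IsIntegral V'] [IsProper ρ]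
        (q' : (R'.strictTransformPlus S.i.ker).subscheme ⟶ V')
        (hq' : q' ≫ ρ ≫ S.g = (R'.strictTransformPlus S.i.ker).subschemeι ≫ R'.πPlus ≫ S.f)
        (𝒜' : GradedAtlas (S.j + 1) (R'.πPlus ≫ S.f) (R'.strictTransformPlus S.i.ker).subschemeι q'),
        Inv ⟨R'.plus, R'.πPlus ≫ S.f, (R'.strictTransformPlus S.i.ker).subscheme,
            (R'.strictTransformPlus S.i.ker).subschemeι, hlp', V', q', ρ ≫ S.g, hq', S.j + 1, 𝒜'⟩ ∧
          μ ⟨R'.plus, R'.πPlus ≫ S.f, (R'.strictTransformPlus S.i.ker).subscheme,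
            (R'.strictTransformPlus S.i.ker).subschemeι, hlp', V', q', ρ ≫ S.g, hq', S.j + 1, 𝒜'⟩ < μ S)
    (S : Stage k) (hInv : Inv S) : S.toPair.Resolvable := by
  suffices h : ∀ (m : W) (S : Stage k), Inv S → μ S = m → S.toPair.Resolvable from
    h _ S hInv rfl
  intro m
  induction m using WellFoundedLT.induction with
  | ind m ih =>
  intro S hInv hm
  by_cases hreg : Scheme.IsRegular S.X
  · -- resolved: no step
    exact HypersurfacePair.resolvable_of_isRegular _ ((isRegular_iff_isRegular_image S.i).mp hreg)
  · -- one admissible step, then the induction hypothesis at the successor stage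
    obtain ⟨R, hadm, hξ, hgood⟩ := centre S hInv hreg
    have hc : R.IsRegularWeightedCentre := hadm.1
    haveI : IsLocallyNoetherian S.Y := LocallyOfFiniteType.isLocallyNoetherian S.f
    have hY : Scheme.IsRegular S.Y := Scheme.IsRegular.of_smooth S.f (Scheme.isRegular_Spec (.of k))
    -- the Rees filtration of the centre and the successor ambient
    let R' : ReesFiltration S.Y :=
      { ideal := R.piece
        ideal_zero := R.piece_zero
        antitone := antitone_piece hc
        mul_le := R.piece_mul_le }
    obtain ⟨hsm', hsep', hqc'⟩ :=
      WeightedThesis.GlobalCobordantPlus.smooth_πPlus_comp_of_isRegularWeightedCentre S.f R hc R' rfl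
    haveI := hsm'; haveI := hsep'; haveI := hqc'
    obtain ⟨hint', hker⟩ :=
      DatumToEmbedded.StrictTransform.isIntegral_strictTransformPlus_of_not_mem_support S.i R hc R' rfl hξ
    haveI := hint'
    set I' := R'.strictTransformPlus S.i.ker with hI'
    have hI'lp : IsLocallyPrincipal I' :=
      WeightedThesis.HypersurfacePreserved.isLocallyPrincipal_strictTransformPlus hY R hc R' rfl S.i.ker
        S.isLocallyPrincipal
    let i' := I'.subschemeι
    have hlp' : IsLocallyPrincipal i'.ker := by
      rw [Scheme.IdealSheafData.ker_subschemeι]; exact hI'lp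
    let σX : I'.subscheme ⟶ S.X := IsClosedImmersion.lift S.i (i' ≫ R'.πPlus) hker
    have hσX : σX ≫ S.i = i' ≫ R'.πPlus := IsClosedImmersion.lift_fac _ _ _
    -- (hom) of the admissible centre on the charts of the presentation, then the tree's quotient step
    have hH := hadm.2.2
    have hhom : ∀ (a : S.atlas.ι) (n : ℕ), @Ideal.IsHomogeneous (Fin S.j → ℤ)
        (AddSubgroup Γ(S.Y, S.atlas.W a)) Γ(S.Y, S.atlas.W a) _ _ _ (S.atlas.piece a) _ _
        (S.atlas.gradedRing a) ((R.piece n).ideal (S.atlas.W a)) := fun a n =>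
      @hH S.j (S.atlas.W a) (S.atlas.piece a) (S.atlas.gradedRing a) (S.atlas.appLE_mem a)
        (S.atlas.isHomogeneous_ker a) n
    obtain ⟨K, hK, hstep⟩ := DatumToEmbedded.quotientStep_of_isRegularWeightedCentre S.f S.i S.q S.g
      S.hq S.atlas R hc hξ hhom R' rfl σX hσX
    obtain ⟨V', ρ, hρ⟩ := exists_isBlowup S.V K
    haveI : IsLocallyNoetherian S.V := LocallyOfFiniteType.isLocallyNoetherian S.g
    haveI : IsProper ρ := hρ.isProper
    haveI : IsIntegral V' := hρ.isIntegral hK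
    obtain ⟨q', hq', ⟨𝒜'⟩⟩ := hstep V' ρ hρ
    have hq'' : q' ≫ ρ ≫ S.g = i' ≫ R'.πPlus ≫ S.f := by
      rw [← Category.assoc, hq', Category.assoc, S.hq, ← Category.assoc, hσX, Category.assoc]
    -- the successor stage: invariant and measure drop
    let S' : Stage k :=
      { Y := R'.plus, f := R'.πPlus ≫ S.f, X := (R'.strictTransformPlus S.i.ker).subscheme,
        i := (R'.strictTransformPlus S.i.ker).subschemeι, isLocallyPrincipal := hlp',
        V := V', q := q', g := ρ ≫ S.g, hq := hq'', j := S.j + 1, atlas := 𝒜' }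
    obtain ⟨hInv', hlt⟩ : Inv S' ∧ μ S' < μ S :=
      succ S hInv hreg R hadm hξ hgood R' rfl hlp' V' ρ q' hq'' 𝒜'
    -- the induction hypothesis resolves the successor
    obtain ⟨n, hn⟩ := ih _ (hm ▸ hlt) S' hInv' rfl
    -- one more step for `S`
    refine ⟨n + 1, R, hadm, R', rfl, hsm', hsep', hqc', hI'lp, hint', ?_⟩
    have e : (@HypersurfacePair.mk k _ R'.plus (R'.πPlus ≫ S.f) hsm' hsep' hqc' I' hI'lp hint') =
        S'.toPair := by
      simp only [S', Stage.toPair, HypersurfacePair.ofKer]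
      congr 1
      exact (Scheme.IdealSheafData.ker_subschemeι I').symm
    rw [← e] at hn
    exact hn

/-- **The generic point of the hypersurface is off a centre supported on `singImage`** (the function field of the
integral scheme `X` is regular; lines 55–63 of `e1_assembly_unconditional`, extracted). [folklore] -/
theorem genericPoint_not_mem_support_of_support_eq (S : Stage k) (R : ReesAlgebraData S.Y)
    (hsupp : R.support = singImage S.i.ker) : S.i (genericPoint S.X) ∉ R.support := by
  rw [hsupp]
  rintro ⟨x', hx', hnreg⟩
  obtain ⟨x₀, rfl⟩ := S.i.toImage.surjective x'
  rw [toImage_apply_eq_iff] at hx'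
  obtain rfl : x₀ = genericPoint S.X := S.i.isClosedEmbedding.injective hx'
  exact hnreg ((isRegularLocalRing_stalk_image_iff S.i (genericPoint S.X)).mpr
    (inferInstanceAs (IsRegularLocalRing S.X.functionField)))

/-- **The abstract ladder assembly for centres supported on the WHOLE of `singImage` and a drop predicate on the Rees
filtration** (the shape rung `e = 1` instantiates VERBATIM: `Good S R := R.support = singImage S.i.ker ∧ ∀ R',
R'.ideal = R.piece → Drop S R'`; the binders of `succ` are those of `ELadderOne.stub_e1_inv_succ` with
`S.Inv' ↦ Inv S`, `S.mu ↦ μ S`, the `hdrop` line `↦ Drop S R'`, the binders of `centre` those of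
`ELadderOne.exists_isAdmissibleCentre`).  Corollary of `ladder_assembly` through
`genericPoint_not_mem_support_of_support_eq`. [cite: Wlodarczyk2022, §2.3.3, Thm 1.1.4 (5)] -/
theorem ladder_assembly_of_support_eq [PerfectField k] {W : Type} [LT W] [WellFoundedLT W]
    (Inv : Stage k → Prop) (μ : Stage k → W) (Drop : (S : Stage k) → ReesFiltration S.Y → Prop)
    (centre : ∀ S : Stage k, Inv S → ¬ Scheme.IsRegular S.X →
      ∃ R : ReesAlgebraData S.Y, IsAdmissibleCentre S.f S.i.ker R ∧ R.support = singImage S.i.ker ∧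
        ∀ R' : ReesFiltration S.Y, R'.ideal = R.piece → Drop S R')
    (succ : ∀ (S : Stage k), Inv S → ¬ Scheme.IsRegular S.X →
      ∀ (R : ReesAlgebraData S.Y) (_ : IsAdmissibleCentre S.f S.i.ker R) (_ : R.support = singImage S.i.ker)
        (R' : ReesFiltration S.Y) (_ : R'.ideal = R.piece), Drop S R' →
      ∀ [Smooth (R'.πPlus ≫ S.f)] [IsSeparated (R'.πPlus ≫ S.f)] [QuasiCompact (R'.πPlus ≫ S.f)]
        [IsIntegral (R'.strictTransformPlus S.i.ker).subscheme]
        (hlp' : IsLocallyPrincipal (R'.strictTransformPlus S.i.ker).subschemeι.ker)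
        (V' : Scheme.{0}) (ρ : V' ⟶ S.V) [IsIntegral V'] [IsProper ρ]
        (q' : (R'.strictTransformPlus S.i.ker).subscheme ⟶ V')
        (hq' : q' ≫ ρ ≫ S.g = (R'.strictTransformPlus S.i.ker).subschemeι ≫ R'.πPlus ≫ S.f)
        (𝒜' : GradedAtlas (S.j + 1) (R'.πPlus ≫ S.f) (R'.strictTransformPlus S.i.ker).subschemeι q'),
        Inv ⟨R'.plus, R'.πPlus ≫ S.f, (R'.strictTransformPlus S.i.ker).subscheme,
            (R'.strictTransformPlus S.i.ker).subschemeι, hlp', V', q', ρ ≫ S.g, hq', S.j + 1, 𝒜'⟩ ∧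
          μ ⟨R'.plus, R'.πPlus ≫ S.f, (R'.strictTransformPlus S.i.ker).subscheme,
            (R'.strictTransformPlus S.i.ker).subschemeι, hlp', V', q', ρ ≫ S.g, hq', S.j + 1, 𝒜'⟩ < μ S)
    (S : Stage k) (hInv : Inv S) : S.toPair.Resolvable := by
  refine ladder_assembly Inv μ
    (fun S R => R.support = singImage S.i.ker ∧ ∀ R' : ReesFiltration S.Y, R'.ideal = R.piece → Drop S R')
    (fun S hInv hreg => ?_) (fun S hInv hreg R hadm _ hG R' hR' => ?_) S hInv
  · obtain ⟨R, hadm, hsupp, hdrop⟩ := centre S hInv hreg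
    exact ⟨R, hadm, genericPoint_not_mem_support_of_support_eq S R hsupp, hsupp, hdrop⟩
  · intro _ _ _ _ hlp' V' ρ _ _ q' hq' 𝒜'
    exact succ S hInv hreg R hadm hG.1 R' hR' (hG.2 R' hR') hlp' V' ρ q' hq' 𝒜'

end Summit.ResolutionOfSingularities.ResolutionOfSingularities.Theorems.ELadder

end
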